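import Mathlib.Algebra.Module.CharacterModule
import Mathlib.Algebra.Module.Torsion.Basic
import Mathlib.LinearAlgebra.Isomorphisms
import Mathlib.LinearAlgebra.Quotient.Basic
import Mathlib.RingTheory.Ideal.Operations
import HarnessLib

/-!
# X11b, route R1 — the Pontryagin-dual step: `X ⧸ aX ≅ (S[a])^∨` and the congruence isomorphism `e`

HONEST FRAMING (cell `b2b-bsdres`, run/shared/lean/b2b/bsd-rank1-residual/, verbatim in every
file): the goal of the cell is to DELETE the COMBINATION-SHAPED residual classes of the
Birch–Swinnerton-Dyer formula for ALL analytic-rank `≤ 1` elliptic curves over `ℚ` — "full BSD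
formula for every rank `≤ 1` curve in class `C`" assembled STRICTLY from published theorems — so
that the rank-`≤ 1` remainder becomes exactly the CONSTRUCTION-SHAPED classes, which are TYPED
(missing-input `Prop`s), NOT attempted. This is not "finishing BSD". Sub-cell
`b2b-bsdres-multr1-p1` (X11b via the re-proof of Castella 2018 Thm. A along the author's erratum):
a RESEARCH ROUTE; no claim beyond the stated class; X11b stays CONSTRUCTION-SHAPED; nothing here
changes a label. THEOREMS ONLY (Mathlib-only algebra; no definition, no named fact, no `sorry`).

## What this file kernel-checks

The congruence-limit skeleton of route R1
(`CastellaErratumCongruenceLimit.isTorsion_and_charIdeal_eq_of_congruences`, erratum p. 4 /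
[Ski16, p. 192]) takes as hypothesis `e`, for each `m ≥ 1`, an `R`-linear isomorphism
`X ⧸ I^m X ≃ X_m ⧸ I^m X_m` between the Pontryagin duals `X = Sel^Σ_𝔭̄(K, M_f)^∨`,
`X_m = Sel^Σ_𝔭̄(K, M_{g_m})^∨`, `I = (p)` (or `(ϖ)`). The erratum obtains it from (b) and Lemma 2.1
("from (b), Lemma 2.1, and basic properties of Fitting ideals we deduce …"): Lemma 2.1 + (b) give
`Sel(M_f)[p^m] ≃ Sel(M_{g_m})[p^m]`, and PONTRYAGIN DUALITY turns an isomorphism of `p^m`-torsion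
submodules into an isomorphism of the duals modulo `p^m`. This file proves that duality step for
Mathlib's character module `S^∨ = Hom_ℤ(S, ℚ/ℤ)` (`CharacterModule S`, an `R`-module by
`(r • χ)(s) = χ(r s)`; for a discrete torsion abelian group this is the Pontryagin dual as an
abstract `R`-module), for ANY commutative ring `R`, `R`-module `S` and `a ∈ R`:

* `exists_smul_eq_of_forall_torsionBy`: a character vanishing on `S[a]` is `a • ψ` (injectivity
  of `ℚ/ℤ`, Mathlib `CharacterModule.dual_surjective_of_injective`);
* `ker_dual_subtype_torsionBy`: **`ker (S^∨ → (S[a])^∨) = a S^∨`**;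
* `nonempty_quotSMulTop_equiv_dual_torsionBy`: **`S^∨ ⧸ a S^∨ ≃ₗ[R] (S[a])^∨`**, and in the
  skeleton's shape `nonempty_quotIdealPow_equiv_dual_torsionBy`: `S^∨ ⧸ (a)^m • ⊤ ≃ₗ[R] (S[a^m])^∨`;
* `nonempty_quotIdealPow_equiv_of_torsionBy_equiv`: **`S[a^m] ≃ₗ[R] S'[a^m] ⟹
  S^∨ ⧸ (a)^m S^∨ ≃ₗ[R] S'^∨ ⧸ (a)^m S'^∨`** — hypothesis `e` of the skeleton.

Isomorphisms are returned as `Nonempty (_ ≃ₗ[R] _)` (this file is theorems-only; the skeleton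
consumes `e` only to derive equalities of ideals). The composition with the kernel form of
Lemma 2.1 (`SelmerTorsionControl.lean`) and the skeleton is `CastellaErratumSelmerCongruence.lean`.
CONDITIONAL on nothing; deletes nothing; X11b stays CONSTRUCTION-SHAPED.

Convention (recorded, not used): the `Λ`-action on `X = Sel^∨` here is precomposition
(`(λ • χ)(s) = χ(λ s)`), as in [Cas18, §2.1] (`X := Hom_{ℤ_p}(Sel, ℚ_p/ℤ_p)`); no involution `ι`.

References: F. Castella, Erratum, proof of Thm. 1.1 (p. 4) [Castella2018Erratum]; C. Skinner,
Pacific J. Math. 283 (2016), §3.1 (p. 192) [Skinner2016PacificMC]; F. Castella, Camb. J. Math. 6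
(2018), §2.1 and proof of Thm. 2.6 ("by Pontrjagin duality it suffices to show …") [Castella2018].
-/

noncomputable section

namespace Summit.BirchSwinnertonDyer.Rank1Residual.X11b.PontryaginCongruence

open CharacterModule
open scoped Pointwise

variable {R : Type*} [CommRing R] {S : Type*} [AddCommGroup S] [Module R S]
  {S' : Type*} [AddCommGroup S'] [Module R S']

/-- Restriction of characters to the `a`-torsion is onto (`ℚ/ℤ` is injective; Mathlib
`CharacterModule.dual_surjective_of_injective`). [folklore] -/
theorem dual_subtype_torsionBy_surjective (a : R) :
    Function.Surjective (dual (Submodule.torsionBy R S a).subtype) :=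
  dual_surjective_of_injective _ (Submodule.injective_subtype _)

/-- **A character of `S` vanishing on `S[a]` is `a` times a character**: `χ|_{S[a]} = 0 ⟹
∃ ψ, χ = a • ψ` (`(a • ψ)(s) = ψ(a s)`). Proof: `χ` factors through `S/S[a] ≅ aS`, and the
resulting character of `aS` extends to `S` by injectivity of `ℚ/ℤ`. [folklore] -/
theorem exists_smul_eq_of_forall_torsionBy (a : R) (χ : CharacterModule S)
    (hχ : ∀ s : S, a • s = 0 → χ s = 0) : ∃ ψ : CharacterModule S, a • ψ = χ := by
  let μ : S →ₗ[R] S := DistribSMul.toLinearMap R S a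
  have hμ : ∀ s, μ s = a • s := fun s => rfl
  let N : Submodule R S := LinearMap.ker μ
  have hN : N.restrictScalars ℤ ≤ LinearMap.ker χ.toIntLinearMap := fun s hs => by
    rw [LinearMap.mem_ker]
    exact hχ s (by simpa [N, hμ] using hs)
  let χbar : (S ⧸ N.restrictScalars ℤ) →ₗ[ℤ] AddCircle (1 : ℚ) :=
    (N.restrictScalars ℤ).liftQ χ.toIntLinearMap hN
  let e1 : (S ⧸ N.restrictScalars ℤ) ≃ₗ[ℤ] (S ⧸ N) := Submodule.Quotient.restrictScalarsEquiv ℤ N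
  let e2 : (S ⧸ N) ≃ₗ[R] LinearMap.range μ := μ.quotKerEquivRange
  let χ' : CharacterModule (LinearMap.range μ) :=
    χbar.toAddMonoidHom.comp ((e1.symm.toAddMonoidHom).comp e2.symm.toLinearMap.toAddMonoidHom)
  obtain ⟨ψ, hψ⟩ :=
    dual_surjective_of_injective (LinearMap.range μ).subtype (Submodule.injective_subtype _) χ'
  refine ⟨ψ, CharacterModule.ext (A := S) fun s => ?_⟩
  have hs : μ s ∈ LinearMap.range μ := LinearMap.mem_range_self μ s
  have h1 : (a • ψ) s = dual (LinearMap.range μ).subtype ψ ⟨μ s, hs⟩ := rfl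
  rw [h1, hψ]
  change χbar (e1.symm (e2.symm ⟨μ s, hs⟩)) = χ s
  rw [LinearMap.quotKerEquivRange_symm_apply_image μ s hs]
  change χbar (e1.symm (Submodule.Quotient.mk s)) = χ s
  have h2 : e1.symm (Submodule.Quotient.mk s) = Submodule.Quotient.mk s :=
    Submodule.Quotient.restrictScalarsEquiv_symm_mk ℤ N s
  rw [h2]
  rfl

/-- **`ker (X → (S[a])^∨) = aX`** for `X = S^∨` the character module: a character restricts to
zero on the `a`-torsion iff it is divisible by `a` in `X`. [folklore] -/
theorem ker_dual_subtype_torsionBy (a : R) :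
    LinearMap.ker (dual (Submodule.torsionBy R S a).subtype) =
      a • (⊤ : Submodule R (CharacterModule S)) := by
  ext χ
  rw [LinearMap.mem_ker, Submodule.mem_smul_pointwise_iff_exists]
  constructor
  · intro h
    obtain ⟨ψ, hψ⟩ := exists_smul_eq_of_forall_torsionBy a χ fun s hs =>
      congr($h ⟨s, (Submodule.mem_torsionBy_iff a s).2 hs⟩)
    exact ⟨ψ, Submodule.mem_top, hψ⟩
  · rintro ⟨ψ, -, rfl⟩
    refine CharacterModule.ext (A := Submodule.torsionBy R S a) fun s => ?_
    have hs : a • (s : S) = 0 := (Submodule.mem_torsionBy_iff a (s : S)).1 s.2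
    change ψ (a • (s : S)) = 0
    rw [hs, map_zero]

/-- `(a)^m • X = a^m • X`. [folklore] -/
theorem ideal_span_singleton_pow_smul_top (a : R) (m : ℕ) (X : Type*) [AddCommGroup X]
    [Module R X] : (Ideal.span {a}) ^ m • (⊤ : Submodule R X) = a ^ m • (⊤ : Submodule R X) := by
  rw [Ideal.span_singleton_pow, Submodule.ideal_span_singleton_smul]

/-- **`X ⧸ aX ≃ (S[a])^∨`** for `X = S^∨`: the Pontryagin-dual form of "restriction to the
`a`-torsion" (first isomorphism theorem for the surjection `X → (S[a])^∨` with kernel `aX`).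
[folklore] -/
theorem nonempty_quotSMulTop_equiv_dual_torsionBy (a : R) :
    Nonempty ((CharacterModule S ⧸ a • (⊤ : Submodule R (CharacterModule S))) ≃ₗ[R]
      CharacterModule (Submodule.torsionBy R S a)) :=
  ⟨(Submodule.quotEquivOfEq _ _ (ker_dual_subtype_torsionBy a).symm).trans
    (LinearMap.quotKerEquivOfSurjective _ (dual_subtype_torsionBy_surjective a))⟩

/-- **`X ⧸ (a)^m X ≃ (S[a^m])^∨`** for `X = S^∨`, in the `I^m • ⊤` shape of the congruence-limit
skeleton (`CastellaErratumCongruenceLimit.isTorsion_and_charIdeal_eq_of_congruences`, `I = (a)`).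
[folklore] -/
theorem nonempty_quotIdealPow_equiv_dual_torsionBy (a : R) (m : ℕ) :
    Nonempty ((CharacterModule S ⧸ (Ideal.span {a}) ^ m • (⊤ : Submodule R (CharacterModule S)))
      ≃ₗ[R] CharacterModule (Submodule.torsionBy R S (a ^ m))) := by
  obtain ⟨e⟩ := nonempty_quotSMulTop_equiv_dual_torsionBy (S := S) (a ^ m)
  exact ⟨(Submodule.quotEquivOfEq _ _ (ideal_span_singleton_pow_smul_top a m _)).trans e⟩

/-- **The congruence isomorphism `e` of the skeleton from an isomorphism of `a^m`-torsion
submodules**: if `S[a^m] ≃ S'[a^m]` (`R`-linearly) then `X ⧸ (a)^m X ≃ X' ⧸ (a)^m X'` for the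
character modules `X = S^∨`, `X' = S'^∨`. In route R1: `S = Sel^Σ_𝔭̄(K, M_f)`,
`S' = Sel^Σ_𝔭̄(K, M_{g_m})`, `a = p` (or `ϖ`), and the torsion isomorphism is (b) + Lemma 2.1 of the
erratum; the output is hypothesis `e` of
`CongruenceLimit.isTorsion_and_charIdeal_eq_of_congruences` ("from (b), Lemma 2.1, and basic
properties of Fitting ideals we deduce …", erratum p. 4).
[cite: Castella2018Erratum, proof of Thm. 1.1 (p. 4)] -/
theorem nonempty_quotIdealPow_equiv_of_torsionBy_equiv (a : R) (m : ℕ)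
    (θ : Submodule.torsionBy R S (a ^ m) ≃ₗ[R] Submodule.torsionBy R S' (a ^ m)) :
    Nonempty ((CharacterModule S ⧸ (Ideal.span {a}) ^ m • (⊤ : Submodule R (CharacterModule S)))
      ≃ₗ[R] (CharacterModule S' ⧸ (Ideal.span {a}) ^ m • (⊤ : Submodule R (CharacterModule S')))) := by
  obtain ⟨e⟩ := nonempty_quotIdealPow_equiv_dual_torsionBy (S := S) a m
  obtain ⟨e'⟩ := nonempty_quotIdealPow_equiv_dual_torsionBy (S := S') a m
  exact ⟨e.trans ((CharacterModule.congr θ).trans e'.symm)⟩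

end Summit.BirchSwinnertonDyer.Rank1Residual.X11b.PontryaginCongruence

end
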